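import Summits.NavierStokesRegularity.NavierStokesRegularity.Theorems.PoloidalWindowDoorPoloidalWindowRigidityZShockObliqueProfile
import Literature.Analysis.PDE.DivForm.Liouville
import HarnessLib

/-!
# Crux K2 `PoloidalWindowRigidity` (stmt-NavierStokesRegularity-19708), line `z_shock` — R2½ ON THE HORIZONTAL PLANE `ℝ²`:
# supersonic AND subsonic oblique travelling 2-D profiles of the autonomous thick height-evolution are constant; the slice glue

`--supports stmt-NavierStokesRegularity-19708 --as helper` (leafhand-ns-poloidalwindowdoor-3 g7, cell decomp-ns, 2026-08-31).  Class-free,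
def-free; Mathlib + tree files (`…ZShockObliqueProfile`, p828301; `Literature.Analysis.PDE.DivForm.Liouville` = the tree's PROVED
De Giorgi–Nash–Moser Liouville theorem `divFormLiouville_holds`).  **No stub and no summit is closed by this file; Navier–Stokes regularity is
NOT proved here (rung 0).**

The repair census of the crux (exit report 2026-08-31T16:00Z) lists the oblique travelling 2-D profiles `W(s, y) = Ψ(y − κ₀ s e₁)` of the
autonomous height-evolution `∂ₛ∂ₛW = Σᵢ ∂ᵢ(γ(W)∂ᵢW)` (tree `…ZShockSliceTyping.slice_wave_pde`, `y ∈ EuclideanSpace ℝ (Fin 2)`) with the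
verdict «subsonic ⇒ De Giorgi Liouville, supersonic ⇒ R2, transonic open».  The profile equation on the plane is

  `∂₀(γ(Ψ)∂₀Ψ) = ∂₁((κ₀² − γ(Ψ))∂₁Ψ)`      (`∂_b = fderiv · (EuclideanSpace.single b 1)`).

* `oblique_slice_profile_equation` — THE GLUE: if the drifting pattern `W s y = Ψ(y − (κ₀ s)•e₁)` (`Ψ ∈ C²`) satisfies the slice equation
  in the exact shape of `slice_wave_pde` / `…ZShockWaveLocalEnergy` (`deriv`/`deriv` in `s`, `Σᵢ fderiv (γ(W) ∂ᵢW) eᵢ` in `y`) at height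
  `s = 0`, then `Ψ` solves the profile equation above (chain rule along the drift line; `∂₁(κ₀²∂₁Ψ) − ∂₁(γ∂₁Ψ) = ∂₁((κ₀²−γ)∂₁Ψ)`);
* `obliqueProfile_const_of_supersonic_plane` / `…_antitone` — ★ SUPERSONIC (`0 < γlo ≤ γ ≤ γhi < κ₀²`), THICK with one-signed `γ'`
  (`γ' ≥ 0`, resp. `≤ 0`, not identically zero on any interval), `Ψ ∈ C²` with `Ψ, ∂₀Ψ, ∂₁Ψ` bounded ⇒ `Ψ` constant: transport of
  `…ZShockObliqueProfile.obliqueProfile_const_of_supersonic(_antitone)` along `EuclideanSpace ℝ (Fin 2) ≃L[ℝ] ℝ × ℝ`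
  (`ContinuousLinearEquiv.comp_right_fderiv`);
* `obliqueProfile_const_of_subsonic_plane` — ★ SUBSONIC (`κ₀² < γlo ≤ γ ≤ γhi`), `Ψ ∈ C²` bounded, NO sign / thickness hypothesis on `γ'`
  ⇒ `Ψ` constant: the profile equation is `div(a∇Ψ) = 0` with the bounded measurable uniformly elliptic diagonal field
  `a(y) = diag(γ(Ψ(y)), γ(Ψ(y)) − κ₀²)`; integration by parts against `C¹_c` test functions (Mathlib
  `integral_mul_fderiv_eq_neg_fderiv_mul_of_integrable`) gives the weak equation, and the tree's
  `Literature.Analysis.PDE.DivForm.divFormLiouville_holds` (Jost Thm 14.2.3 / Moser 1961, proved in the tree in every dimension) concludes.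

So, of the census' oblique-profile inhabitant candidates of the autonomous thick column, exactly the TRANSONIC ones (`γ(Ψ) − κ₀²` changing
sign on the range: mixed type, Tricomi) and the supersonic ones with SIGN-CHANGING `γ'` remain; both are named, not hidden.  [folklore]
(steady supersonic / subsonic dichotomy for travelling patterns of a quasilinear wave equation; the analytic inputs are the tree's R2 and
Moser's Liouville theorem.)  presearch: as in `…ZShockObliqueProfile` ([corpus: book:dafermos2005 §7.1/§7.7] for the 1-D step; Moser 1961 /
Jost Thm 14.2.3 is the tree fact `Literature.Analysis.PDE.divFormLiouville`, discharged); galaxy: no relevant hit.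
-/

noncomputable section

namespace Summit.NavierStokesRegularity.NavierStokesRegularity.Theorems.PoloidalWindowDoorPoloidalWindowRigidityZShockObliqueProfilePlane

-- the summit and its single sub-problem share the name (CONVENTIONS §1)
set_option linter.dupNamespace false

open Set Filter Topology Function MeasureTheory
open scoped Matrix
open Summit.NavierStokesRegularity.NavierStokesRegularity.Theorems.PoloidalWindowDoorPoloidalWindowRigidityZShockObliqueProfile

variable {Ψ : EuclideanSpace ℝ (Fin 2) → ℝ} {γ γ' Γ : ℝ → ℝ} {κ₀ γlo γhi g₁ Ψ₀ Ψ₁ MΨ : ℝ}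

/-! ### The slice glue: drifting patterns of the height-evolution solve the profile equation -/

/-- **The profile equation of an oblique travelling pattern.**  Let `Ψ : ℝ² → ℝ` be `C²`, `γ ∈ C¹`, and suppose the drifting pattern
`W s y = Ψ (y − (κ₀ s) • e₁)` satisfies, at height `s = 0` and every `y`, the slice equation in the shape of
`…ZShockSliceTyping.slice_wave_pde` / `…ZShockWaveLocalEnergy.waveEnergy_balance`:
`∂ₛ∂ₛW = Σᵢ ∂ᵢ(γ(W) ∂ᵢW)`.  Then `Ψ` solves `∂₀(γ(Ψ)∂₀Ψ) = ∂₁((κ₀² − γ(Ψ))∂₁Ψ)` on the plane. [folklore] -/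
theorem oblique_slice_profile_equation (hΨ : ContDiff ℝ 2 Ψ) (hγ : ContDiff ℝ 1 γ)
    (hpde : ∀ y : EuclideanSpace ℝ (Fin 2),
      deriv (fun s' => deriv (fun s'' => Ψ (y - (κ₀ * s'') • EuclideanSpace.single 1 1)) s') 0 =
        ∑ i, fderiv ℝ (fun y' => γ (Ψ y') * fderiv ℝ Ψ y' (EuclideanSpace.single i 1)) y (EuclideanSpace.single i 1)) :
    ∀ y : EuclideanSpace ℝ (Fin 2),
      fderiv ℝ (fun y' => γ (Ψ y') * fderiv ℝ Ψ y' (EuclideanSpace.single 0 1)) y (EuclideanSpace.single 0 1) =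
        fderiv ℝ (fun y' => (κ₀ ^ 2 - γ (Ψ y')) * fderiv ℝ Ψ y' (EuclideanSpace.single 1 1)) y (EuclideanSpace.single 1 1) := by
  have hΨd : Differentiable ℝ Ψ := hΨ.differentiable two_ne_zero
  have hDΨ : ContDiff ℝ 1 (fderiv ℝ Ψ) := hΨ.fderiv_right (m := 1) le_rfl
  have hΨ1c : ContDiff ℝ 1 fun y' => fderiv ℝ Ψ y' (EuclideanSpace.single 1 1) := hDΨ.clm_apply contDiff_const
  have hΨ1d : Differentiable ℝ fun y' => fderiv ℝ Ψ y' (EuclideanSpace.single 1 1) := hΨ1c.differentiable one_ne_zero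
  have hγΨ : ContDiff ℝ 1 fun y' => γ (Ψ y') := hγ.comp (hΨ.of_le one_le_two)
  have hγΨd : Differentiable ℝ fun y' => γ (Ψ y') := hγΨ.differentiable one_ne_zero
  -- the drift line and the first `s`-derivative
  have hline : ∀ (y : EuclideanSpace ℝ (Fin 2)) (s : ℝ),
      HasDerivAt (fun s'' : ℝ => y - (κ₀ * s'') • EuclideanSpace.single (1 : Fin 2) (1 : ℝ))
        (-(κ₀ • EuclideanSpace.single (1 : Fin 2) (1 : ℝ))) s := by
    intro y s
    have h1 : HasDerivAt (fun s'' : ℝ => κ₀ * s'') κ₀ s := by simpa using (hasDerivAt_id s).const_mul κ₀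
    exact (h1.smul_const (EuclideanSpace.single (1 : Fin 2) (1 : ℝ))).const_sub y
  have hfirst : ∀ (y : EuclideanSpace ℝ (Fin 2)) (s : ℝ),
      deriv (fun s'' => Ψ (y - (κ₀ * s'') • EuclideanSpace.single 1 1)) s =
        -κ₀ * fderiv ℝ Ψ (y - (κ₀ * s) • EuclideanSpace.single 1 1) (EuclideanSpace.single 1 1) := by
    intro y s
    have h : HasDerivAt (fun s'' => Ψ (y - (κ₀ * s'') • EuclideanSpace.single 1 1))
        (fderiv ℝ Ψ (y - (κ₀ * s) • EuclideanSpace.single 1 1) (-(κ₀ • EuclideanSpace.single (1 : Fin 2) (1 : ℝ)))) s :=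
      (hΨd _).hasFDerivAt.comp_hasDerivAt s (hline y s)
    rw [h.deriv, map_neg, map_smul, smul_eq_mul]
    ring
  -- the second `s`-derivative at `s = 0`
  have hsecond : ∀ y : EuclideanSpace ℝ (Fin 2),
      deriv (fun s' => deriv (fun s'' => Ψ (y - (κ₀ * s'') • EuclideanSpace.single 1 1)) s') 0 =
        κ₀ ^ 2 * fderiv ℝ (fun y' => fderiv ℝ Ψ y' (EuclideanSpace.single 1 1)) y (EuclideanSpace.single 1 1) := by
    intro y
    have hfun : (fun s' => deriv (fun s'' => Ψ (y - (κ₀ * s'') • EuclideanSpace.single 1 1)) s') =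
        fun s' => -κ₀ * fderiv ℝ Ψ (y - (κ₀ * s') • EuclideanSpace.single 1 1) (EuclideanSpace.single 1 1) :=
      funext fun s' => hfirst y s'
    rw [hfun]
    have h : HasDerivAt (fun s' => -κ₀ * fderiv ℝ Ψ (y - (κ₀ * s') • EuclideanSpace.single 1 1) (EuclideanSpace.single 1 1))
        (-κ₀ * fderiv ℝ (fun y' => fderiv ℝ Ψ y' (EuclideanSpace.single 1 1)) (y - (κ₀ * (0 : ℝ)) • EuclideanSpace.single 1 1)
          (-(κ₀ • EuclideanSpace.single (1 : Fin 2) (1 : ℝ)))) 0 :=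
      ((hΨ1d _).hasFDerivAt.comp_hasDerivAt (0 : ℝ) (hline y 0)).const_mul (-κ₀)
    rw [h.deriv, map_neg, map_smul, smul_eq_mul, mul_zero, zero_smul, sub_zero]
    ring
  -- the horizontal divergence, split
  intro y
  have hR := hpde y
  rw [hsecond y, Fin.sum_univ_two] at hR
  -- `∂₁((κ₀² − γ)∂₁Ψ) = κ₀² ∂₁∂₁Ψ − ∂₁(γ ∂₁Ψ)`
  have hsplit : fderiv ℝ (fun y' => (κ₀ ^ 2 - γ (Ψ y')) * fderiv ℝ Ψ y' (EuclideanSpace.single 1 1)) y (EuclideanSpace.single 1 1) =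
      κ₀ ^ 2 * fderiv ℝ (fun y' => fderiv ℝ Ψ y' (EuclideanSpace.single 1 1)) y (EuclideanSpace.single 1 1) -
        fderiv ℝ (fun y' => γ (Ψ y') * fderiv ℝ Ψ y' (EuclideanSpace.single 1 1)) y (EuclideanSpace.single 1 1) := by
    have hf : (fun y' => (κ₀ ^ 2 - γ (Ψ y')) * fderiv ℝ Ψ y' (EuclideanSpace.single 1 1)) =
        fun y' => κ₀ ^ 2 * fderiv ℝ Ψ y' (EuclideanSpace.single 1 1) - γ (Ψ y') * fderiv ℝ Ψ y' (EuclideanSpace.single 1 1) := by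
      funext y'; ring
    have hBd : Differentiable ℝ fun y' => γ (Ψ y') * fderiv ℝ Ψ y' (EuclideanSpace.single 1 1) :=
      (hγΨ.mul hΨ1c).differentiable one_ne_zero
    have hF : HasFDerivAt (fun y' => κ₀ ^ 2 * fderiv ℝ Ψ y' (EuclideanSpace.single 1 1) -
        γ (Ψ y') * fderiv ℝ Ψ y' (EuclideanSpace.single 1 1))
        (κ₀ ^ 2 • fderiv ℝ (fun y' => fderiv ℝ Ψ y' (EuclideanSpace.single 1 1)) y -
          fderiv ℝ (fun y' => γ (Ψ y') * fderiv ℝ Ψ y' (EuclideanSpace.single 1 1)) y) y :=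
      ((hΨ1d y).hasFDerivAt.const_mul (κ₀ ^ 2)).sub (hBd y).hasFDerivAt
    rw [hf, hF.fderiv, sub_apply, smul_apply, smul_eq_mul]
  rw [hsplit]
  linarith

/-! ### Supersonic profiles on the plane (transport of `…ZShockObliqueProfile`) -/

/-- ★ **R2½ on the plane — supersonic, `γ' ≥ 0`.**  `Ψ : ℝ² → ℝ` of class `C²` with `Ψ`, `∂₀Ψ`, `∂₁Ψ` bounded solves
`∂₀(γ(Ψ)∂₀Ψ) = ∂₁((κ₀² − γ(Ψ))∂₁Ψ)`; `γ ∈ C¹` with `C²` primitive `Γ`, `0 < γlo ≤ γ ≤ γhi < κ₀²`, `|γ'| ≤ g₁`, `γ' ≥ 0` continuous and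
not identically zero on any interval.  Then `Ψ` is constant.  (Transport of `obliqueProfile_const_of_supersonic` along the coordinate
isomorphism `EuclideanSpace ℝ (Fin 2) ≃L[ℝ] ℝ × ℝ`.) [folklore] -/
theorem obliqueProfile_const_of_supersonic_plane (hΨ : ContDiff ℝ 2 Ψ)
    (hΓ2 : ContDiff ℝ 2 Γ) (hΓd : ∀ r, HasDerivAt Γ (γ r) r) (hγd : ∀ r, HasDerivAt γ (γ' r) r) (hγ'c : Continuous γ')
    (hpde : ∀ y : EuclideanSpace ℝ (Fin 2),
      fderiv ℝ (fun y' => γ (Ψ y') * fderiv ℝ Ψ y' (EuclideanSpace.single 0 1)) y (EuclideanSpace.single 0 1) =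
        fderiv ℝ (fun y' => (κ₀ ^ 2 - γ (Ψ y')) * fderiv ℝ Ψ y' (EuclideanSpace.single 1 1)) y (EuclideanSpace.single 1 1))
    (hγlo0 : 0 < γlo) (hγlo : ∀ r, γlo ≤ γ r) (hγhi : ∀ r, γ r ≤ γhi) (hsuper : γhi < κ₀ ^ 2)
    (hgnl : ∀ r, 0 ≤ γ' r) (hgn : ∀ a b : ℝ, a < b → ∃ r ∈ Ioo a b, γ' r ≠ 0) (hg₁ : ∀ r, |γ' r| ≤ g₁)
    (hΨ₁ : ∀ y, |fderiv ℝ Ψ y (EuclideanSpace.single 1 1)| ≤ Ψ₁) (hΨ₀ : ∀ y, |fderiv ℝ Ψ y (EuclideanSpace.single 0 1)| ≤ Ψ₀)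
    (hMΨ : ∀ y, |Ψ y| ≤ MΨ) :
    ∀ y y' : EuclideanSpace ℝ (Fin 2), Ψ y = Ψ y' := by
  -- the coordinate isomorphism
  set e : EuclideanSpace ℝ (Fin 2) ≃L[ℝ] ℝ × ℝ :=
    (EuclideanSpace.equiv (Fin 2) ℝ).trans (ContinuousLinearEquiv.finTwoArrow ℝ ℝ) with he_def
  have hes0 : e.symm (1, 0) = EuclideanSpace.single 0 1 := by
    ext i; fin_cases i <;> simp [he_def]
  have hes1 : e.symm (0, 1) = EuclideanSpace.single 1 1 := by
    ext i; fin_cases i <;> simp [he_def]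
  -- transport of first derivatives
  have hD : ∀ (G : EuclideanSpace ℝ (Fin 2) → ℝ) (q v : ℝ × ℝ),
      fderiv ℝ (G ∘ ⇑e.symm) q v = fderiv ℝ G (e.symm q) (e.symm v) := by
    intro G q v
    rw [e.symm.comp_right_fderiv]
    rfl
  have hΦ2 : ContDiff ℝ 2 (Ψ ∘ ⇑e.symm) := hΨ.comp e.symm.contDiff
  have hΦ0 : ∀ q, fderiv ℝ (Ψ ∘ ⇑e.symm) q (1, 0) = fderiv ℝ Ψ (e.symm q) (EuclideanSpace.single 0 1) := fun q => by
    rw [hD, hes0]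
  have hΦ1 : ∀ q, fderiv ℝ (Ψ ∘ ⇑e.symm) q (0, 1) = fderiv ℝ Ψ (e.symm q) (EuclideanSpace.single 1 1) := fun q => by
    rw [hD, hes1]
  -- transport of the equation
  have hpdeΦ : ∀ q : ℝ × ℝ, fderiv ℝ (fun q' => γ ((Ψ ∘ ⇑e.symm) q') * fderiv ℝ (Ψ ∘ ⇑e.symm) q' (1, 0)) q (1, 0) =
      fderiv ℝ (fun q' => (κ₀ ^ 2 - γ ((Ψ ∘ ⇑e.symm) q')) * fderiv ℝ (Ψ ∘ ⇑e.symm) q' (0, 1)) q (0, 1) := by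
    intro q
    have h1 : (fun q' => γ ((Ψ ∘ ⇑e.symm) q') * fderiv ℝ (Ψ ∘ ⇑e.symm) q' (1, 0)) =
        (fun y' => γ (Ψ y') * fderiv ℝ Ψ y' (EuclideanSpace.single 0 1)) ∘ ⇑e.symm := by
      funext q'; simp only [Function.comp_apply, hΦ0]
    have h2 : (fun q' => (κ₀ ^ 2 - γ ((Ψ ∘ ⇑e.symm) q')) * fderiv ℝ (Ψ ∘ ⇑e.symm) q' (0, 1)) =
        (fun y' => (κ₀ ^ 2 - γ (Ψ y')) * fderiv ℝ Ψ y' (EuclideanSpace.single 1 1)) ∘ ⇑e.symm := by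
      funext q'; simp only [Function.comp_apply, hΦ1]
    rw [h1, h2, hD, hD, hes0, hes1]
    exact hpde (e.symm q)
  have key := obliqueProfile_const_of_supersonic (Φ := Ψ ∘ ⇑e.symm) hΦ2 hΓ2 hΓd hγd hγ'c hpdeΦ hγlo0 hγlo hγhi hsuper hgnl hgn hg₁
    (fun q => by rw [hΦ1]; exact hΨ₁ _) (fun q => by rw [hΦ0]; exact hΨ₀ _) (fun q => hMΨ _)
  intro y y'
  have h := key (e y) (e y')
  simpa using h

/-- ★ **R2½ on the plane — supersonic, `γ' ≤ 0`.**  As `obliqueProfile_const_of_supersonic_plane` with the other sign of `γ'`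
(transport of `obliqueProfile_const_of_supersonic_antitone`). [folklore] -/
theorem obliqueProfile_const_of_supersonic_plane_antitone (hΨ : ContDiff ℝ 2 Ψ)
    (hΓ2 : ContDiff ℝ 2 Γ) (hΓd : ∀ r, HasDerivAt Γ (γ r) r) (hγd : ∀ r, HasDerivAt γ (γ' r) r) (hγ'c : Continuous γ')
    (hpde : ∀ y : EuclideanSpace ℝ (Fin 2),
      fderiv ℝ (fun y' => γ (Ψ y') * fderiv ℝ Ψ y' (EuclideanSpace.single 0 1)) y (EuclideanSpace.single 0 1) =
        fderiv ℝ (fun y' => (κ₀ ^ 2 - γ (Ψ y')) * fderiv ℝ Ψ y' (EuclideanSpace.single 1 1)) y (EuclideanSpace.single 1 1))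
    (hγlo0 : 0 < γlo) (hγlo : ∀ r, γlo ≤ γ r) (hγhi : ∀ r, γ r ≤ γhi) (hsuper : γhi < κ₀ ^ 2)
    (hgnl : ∀ r, γ' r ≤ 0) (hgn : ∀ a b : ℝ, a < b → ∃ r ∈ Ioo a b, γ' r ≠ 0) (hg₁ : ∀ r, |γ' r| ≤ g₁)
    (hΨ₁ : ∀ y, |fderiv ℝ Ψ y (EuclideanSpace.single 1 1)| ≤ Ψ₁) (hΨ₀ : ∀ y, |fderiv ℝ Ψ y (EuclideanSpace.single 0 1)| ≤ Ψ₀)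
    (hMΨ : ∀ y, |Ψ y| ≤ MΨ) :
    ∀ y y' : EuclideanSpace ℝ (Fin 2), Ψ y = Ψ y' := by
  set e : EuclideanSpace ℝ (Fin 2) ≃L[ℝ] ℝ × ℝ :=
    (EuclideanSpace.equiv (Fin 2) ℝ).trans (ContinuousLinearEquiv.finTwoArrow ℝ ℝ) with he_def
  have hes0 : e.symm (1, 0) = EuclideanSpace.single 0 1 := by
    ext i; fin_cases i <;> simp [he_def]
  have hes1 : e.symm (0, 1) = EuclideanSpace.single 1 1 := by
    ext i; fin_cases i <;> simp [he_def]
  -- transport of first derivatives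
  have hD : ∀ (G : EuclideanSpace ℝ (Fin 2) → ℝ) (q v : ℝ × ℝ),
      fderiv ℝ (G ∘ ⇑e.symm) q v = fderiv ℝ G (e.symm q) (e.symm v) := by
    intro G q v
    rw [e.symm.comp_right_fderiv]
    rfl
  have hΦ2 : ContDiff ℝ 2 (Ψ ∘ ⇑e.symm) := hΨ.comp e.symm.contDiff
  have hΦ0 : ∀ q, fderiv ℝ (Ψ ∘ ⇑e.symm) q (1, 0) = fderiv ℝ Ψ (e.symm q) (EuclideanSpace.single 0 1) := fun q => by
    rw [hD, hes0]
  have hΦ1 : ∀ q, fderiv ℝ (Ψ ∘ ⇑e.symm) q (0, 1) = fderiv ℝ Ψ (e.symm q) (EuclideanSpace.single 1 1) := fun q => by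
    rw [hD, hes1]
  -- transport of the equation
  have hpdeΦ : ∀ q : ℝ × ℝ, fderiv ℝ (fun q' => γ ((Ψ ∘ ⇑e.symm) q') * fderiv ℝ (Ψ ∘ ⇑e.symm) q' (1, 0)) q (1, 0) =
      fderiv ℝ (fun q' => (κ₀ ^ 2 - γ ((Ψ ∘ ⇑e.symm) q')) * fderiv ℝ (Ψ ∘ ⇑e.symm) q' (0, 1)) q (0, 1) := by
    intro q
    have h1 : (fun q' => γ ((Ψ ∘ ⇑e.symm) q') * fderiv ℝ (Ψ ∘ ⇑e.symm) q' (1, 0)) =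
        (fun y' => γ (Ψ y') * fderiv ℝ Ψ y' (EuclideanSpace.single 0 1)) ∘ ⇑e.symm := by
      funext q'; simp only [Function.comp_apply, hΦ0]
    have h2 : (fun q' => (κ₀ ^ 2 - γ ((Ψ ∘ ⇑e.symm) q')) * fderiv ℝ (Ψ ∘ ⇑e.symm) q' (0, 1)) =
        (fun y' => (κ₀ ^ 2 - γ (Ψ y')) * fderiv ℝ Ψ y' (EuclideanSpace.single 1 1)) ∘ ⇑e.symm := by
      funext q'; simp only [Function.comp_apply, hΦ1]
    rw [h1, h2, hD, hD, hes0, hes1]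
    exact hpde (e.symm q)
  have key := obliqueProfile_const_of_supersonic_antitone (Φ := Ψ ∘ ⇑e.symm) hΦ2 hΓ2 hΓd hγd hγ'c hpdeΦ hγlo0 hγlo hγhi hsuper hgnl hgn hg₁
    (fun q => by rw [hΦ1]; exact hΨ₁ _) (fun q => by rw [hΦ0]; exact hΨ₀ _) (fun q => hMΨ _)
  intro y y'
  have h := key (e y) (e y')
  simpa using h

/-! ### Subsonic profiles on the plane (the tree's De Giorgi–Nash–Moser Liouville theorem) -/

/-- ★ **R2½ on the plane — subsonic.**  `Ψ : ℝ² → ℝ` of class `C²` and bounded solves `∂₀(γ(Ψ)∂₀Ψ) = ∂₁((κ₀² − γ(Ψ))∂₁Ψ)`, and the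
drift is uniformly SUBSONIC: `κ₀² < γlo ≤ γ ≤ γhi` (`γ ∈ C¹`; no sign or thickness hypothesis on `γ'`).  Then `Ψ` is constant.  Proof:
the equation is `div(a∇Ψ) = 0` for the diagonal field `a = diag(γ(Ψ), γ(Ψ) − κ₀²)` (measurable, symmetric, `(γlo − κ₀²)|ξ|² ≤ ξ·aξ`,
`|aᵢⱼ| ≤ γhi`); integrating by parts against `C¹_c` test functions gives the weak equation, and
`Literature.Analysis.PDE.DivForm.divFormLiouville_holds` (Jost Thm 14.2.3 / Moser 1961, proved in the tree) applies. [folklore] -/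
theorem obliqueProfile_const_of_subsonic_plane (hΨ : ContDiff ℝ 2 Ψ) (hγ : ContDiff ℝ 1 γ)
    (hpde : ∀ y : EuclideanSpace ℝ (Fin 2),
      fderiv ℝ (fun y' => γ (Ψ y') * fderiv ℝ Ψ y' (EuclideanSpace.single 0 1)) y (EuclideanSpace.single 0 1) =
        fderiv ℝ (fun y' => (κ₀ ^ 2 - γ (Ψ y')) * fderiv ℝ Ψ y' (EuclideanSpace.single 1 1)) y (EuclideanSpace.single 1 1))
    (hsub : κ₀ ^ 2 < γlo) (hγlo : ∀ r, γlo ≤ γ r) (hγhi : ∀ r, γ r ≤ γhi) (hMΨ : ∀ y, |Ψ y| ≤ MΨ) :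
    ∀ y y' : EuclideanSpace ℝ (Fin 2), Ψ y = Ψ y' := by
  have hκ₀ : 0 ≤ κ₀ ^ 2 := sq_nonneg _
  have hγpos : ∀ r, 0 < γ r := fun r => (hκ₀.trans_lt hsub).trans_le (hγlo r)
  have hγκ : ∀ r, 0 < γ r - κ₀ ^ 2 := fun r => by linarith [hγlo r]
  have hγhi0 : 0 ≤ γhi := (hγpos 0).le.trans (hγhi 0)
  -- regularity bookkeeping
  have hΨd : Differentiable ℝ Ψ := hΨ.differentiable two_ne_zero
  have hDΨ : ContDiff ℝ 1 (fderiv ℝ Ψ) := hΨ.fderiv_right (m := 1) le_rfl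
  have hΨic : ∀ i : Fin 2, ContDiff ℝ 1 fun y' => fderiv ℝ Ψ y' (EuclideanSpace.single i 1) :=
    fun i => hDΨ.clm_apply contDiff_const
  have hγΨ : ContDiff ℝ 1 fun y' => γ (Ψ y') := hγ.comp (hΨ.of_le one_le_two)
  have hγΨc : Continuous fun y' => γ (Ψ y') := hγΨ.continuous
  -- the two flux components
  set F₀ : EuclideanSpace ℝ (Fin 2) → ℝ := fun y' => γ (Ψ y') * fderiv ℝ Ψ y' (EuclideanSpace.single 0 1) with hF₀_def
  set F₁ : EuclideanSpace ℝ (Fin 2) → ℝ := fun y' => (γ (Ψ y') - κ₀ ^ 2) * fderiv ℝ Ψ y' (EuclideanSpace.single 1 1) with hF₁_def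
  have hF₀ : ContDiff ℝ 1 F₀ := hγΨ.mul (hΨic 0)
  have hF₁ : ContDiff ℝ 1 F₁ := (hγΨ.sub contDiff_const).mul (hΨic 1)
  have hdiv : ∀ y, fderiv ℝ F₀ y (EuclideanSpace.single 0 1) + fderiv ℝ F₁ y (EuclideanSpace.single 1 1) = 0 := by
    intro y
    have h1 : (fun y' => (κ₀ ^ 2 - γ (Ψ y')) * fderiv ℝ Ψ y' (EuclideanSpace.single 1 1)) = fun y' => -F₁ y' := by
      funext y'; simp only [hF₁_def]; ring
    have h2 := hpde y
    rw [h1, fderiv_fun_neg, neg_apply] at h2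
    rw [hF₀_def, h2]
    ring
  -- the coefficient field
  set a : EuclideanSpace ℝ (Fin 2) → Matrix (Fin 2) (Fin 2) ℝ :=
    fun y => Matrix.of fun i j => if i = j then (if i = 0 then γ (Ψ y) else γ (Ψ y) - κ₀ ^ 2) else 0 with ha_def
  have hmeas : ∀ i j, Measurable fun y => a y i j := by
    intro i j
    simp only [ha_def, Matrix.of_apply]
    split_ifs
    · exact hγΨc.measurable
    · exact (hγΨc.sub continuous_const).measurable
    · exact measurable_const
  have hsymm : ∀ y, (a y).IsSymm := by
    intro y
    refine Matrix.IsSymm.ext fun i j => ?_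
    simp only [ha_def, Matrix.of_apply]
    by_cases h : i = j
    · subst h; rfl
    · rw [if_neg h, if_neg (Ne.symm h)]
  have hell : ∀ y (ξ : Fin 2 → ℝ), (γlo - κ₀ ^ 2) * (ξ ⬝ᵥ ξ) ≤ ξ ⬝ᵥ (a y *ᵥ ξ) := by
    intro y ξ
    simp only [ha_def, dotProduct, Matrix.mulVec, Matrix.of_apply, Fin.sum_univ_two, Fin.isValue, ↓reduceIte, one_ne_zero,
      zero_ne_one]
    have h0 := hγlo (Ψ y)
    nlinarith [sq_nonneg (ξ 0), sq_nonneg (ξ 1), mul_nonneg hκ₀ (sq_nonneg (ξ 0))]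
  have hbd : ∀ y i j, |a y i j| ≤ γhi := by
    intro y i j
    simp only [ha_def, Matrix.of_apply]
    split_ifs
    · rw [abs_of_pos (hγpos _)]; exact hγhi _
    · rw [abs_of_pos (hγκ _)]; linarith [hγhi (Ψ y)]
    · rw [abs_zero]; exact hγhi0
  -- the weak equation by integration by parts
  have hweak : ∀ η : EuclideanSpace ℝ (Fin 2) → ℝ, ContDiff ℝ 1 η → HasCompactSupport η →
      ∫ y, ∑ i, ∑ j, a y i j * fderiv ℝ Ψ y (EuclideanSpace.single i 1) * fderiv ℝ η y (EuclideanSpace.single j 1) = 0 := by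
    intro η hη hηs
    have hηc : Continuous η := hη.continuous
    have hηd : Differentiable ℝ η := hη.differentiable one_ne_zero
    have hη'c : ∀ v, Continuous fun y => fderiv ℝ η y v := fun v => (hη.continuous_fderiv one_ne_zero).clm_apply continuous_const
    have hη's : ∀ v, HasCompactSupport fun y => fderiv ℝ η y v := fun v => hηs.fderiv_apply (𝕜 := ℝ) v
    have hintegrand : ∀ y, (∑ i, ∑ j, a y i j * fderiv ℝ Ψ y (EuclideanSpace.single i 1) * fderiv ℝ η y (EuclideanSpace.single j 1)) =
        F₀ y * fderiv ℝ η y (EuclideanSpace.single 0 1) + F₁ y * fderiv ℝ η y (EuclideanSpace.single 1 1) := by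
      intro y
      simp only [ha_def, Matrix.of_apply, Fin.sum_univ_two, Fin.isValue, ↓reduceIte, one_ne_zero, zero_ne_one, hF₀_def,
        hF₁_def]
      ring
    simp_rw [hintegrand]
    -- integrability of all the products (continuous × compactly supported)
    have hFc : ∀ {F : EuclideanSpace ℝ (Fin 2) → ℝ}, ContDiff ℝ 1 F → ∀ v,
        Integrable (fun y => fderiv ℝ F y v * η y) ∧ Integrable (fun y => F y * fderiv ℝ η y v) ∧ Integrable (fun y => F y * η y) := by
      intro F hF v
      have hFc : Continuous F := hF.continuous
      have hF'c : Continuous fun y => fderiv ℝ F y v := (hF.continuous_fderiv one_ne_zero).clm_apply continuous_const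
      exact ⟨(hF'c.mul hηc).integrable_of_hasCompactSupport hηs.mul_left,
        (hFc.mul (hη'c v)).integrable_of_hasCompactSupport (hη's v).mul_left,
        (hFc.mul hηc).integrable_of_hasCompactSupport hηs.mul_left⟩
    obtain ⟨h0a, h0b, h0c⟩ := hFc hF₀ (EuclideanSpace.single 0 1)
    obtain ⟨h1a, h1b, h1c⟩ := hFc hF₁ (EuclideanSpace.single 1 1)
    have hibp0 : ∫ y, F₀ y * fderiv ℝ η y (EuclideanSpace.single 0 1) = -∫ y, fderiv ℝ F₀ y (EuclideanSpace.single 0 1) * η y :=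
      integral_mul_fderiv_eq_neg_fderiv_mul_of_integrable h0a h0b h0c
        (fun y _ => (hF₀.differentiable one_ne_zero) y) (fun y _ => hηd y)
    have hibp1 : ∫ y, F₁ y * fderiv ℝ η y (EuclideanSpace.single 1 1) = -∫ y, fderiv ℝ F₁ y (EuclideanSpace.single 1 1) * η y :=
      integral_mul_fderiv_eq_neg_fderiv_mul_of_integrable h1a h1b h1c
        (fun y _ => (hF₁.differentiable one_ne_zero) y) (fun y _ => hηd y)
    rw [integral_add h0b h1b, hibp0, hibp1, ← neg_add, ← integral_add h0a h1a]
    have hzero : (fun y => fderiv ℝ F₀ y (EuclideanSpace.single 0 1) * η y + fderiv ℝ F₁ y (EuclideanSpace.single 1 1) * η y) =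
        fun _ => 0 := by
      funext y
      rw [← add_mul, hdiv y, zero_mul]
    rw [hzero, integral_zero, neg_zero]
  -- Moser's Liouville theorem
  exact Literature.Analysis.PDE.DivForm.divFormLiouville_holds 2 a (γlo - κ₀ ^ 2) γhi (sub_pos.2 hsub) hmeas hsymm hell hbd Ψ
    (hΨ.of_le one_le_two) ⟨MΨ, hMΨ⟩ hweak

end Summit.NavierStokesRegularity.NavierStokesRegularity.Theorems.PoloidalWindowDoorPoloidalWindowRigidityZShockObliqueProfilePlane
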